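import Summits.BirchSwinnertonDyer.BirchSwinnertonDyer.Theorems.ResidualThetaTransportAtTwoSignedMuSeedAtTwoPlusCMManinPeriodSeparating
import HarnessLib

/-!
# CM Manin period V — from a Frobenius with cube-root residues to the separating idempotent (step (c) of the line card `cm-manin-period`
# made turnkey; seed crux `SignedMuSeedAtTwoPlus` stmt-BirchSwinnertonDyer-21438, parent Kμ⁺ stmt-BirchSwinnertonDyer-20689, route ResidualThetaTransportAtTwo)

Cell `bsd-wall`, width seat `bsd-wall-rtt-p4-w2` g16 (`--supports`, closes nothing).  THEOREMS ONLY; BSD is not proved by this.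

Card, step (c): the Galois algebra `S = O_L[ρ_B(G_K)] ⊆ ∏_τ O_L` contains `t = ρ_B(Frob_(α))` whose residues are `ζ₃` on one `K`-embedding class of
`τ` and `ζ₃²` on the other («`x ↦ x`, `x ↦ x²` differ on `𝔽₄ˣ`»).  `…CMManinPeriodSeparating.lean` needs an element with residues `1/0`; this file
does the normalisation `t' = (t − ζ²)(ζ − ζ²)⁻¹` and concludes:

* `cubeRoot_sub_sq_sq`, **`isUnit_cubeRoot_sub_sq`** — `ζ² + ζ + 1 = 0` ⇒ `(ζ − ζ²)² = −3`, a unit when `3` is (residue characteristic `≠ 3`, e.g. `2`);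
* `normalise_residue_one`, `normalise_residue_zero`, `not_mem_of_sub_cubeRoot_sq_mem` — residues of `t'` are `1` where `t ≡ ζ`, `0` where `t ≡ ζ²`,
  and the two classes are disjoint; `exists_sub_mem_and_sub_one_mem` — CRT for the auxiliary Frobenius (`α ≡ r (mod I)`, `α ≡ 1 (mod J)`, `I, J` coprime);
* **`indicator_mem_subalgebra_of_cubeRoot_residues`** — `O` complete Noetherian local with `3 ∈ Oˣ`, `ζ ∈ O` a primitive cube root, `ι` finite,
  `S ⊆ (ι → O)` any `O`-subalgebra, `t ∈ S` with `t i ≡ ζ` or `t i ≡ ζ²` for every `i` ⇒ the indicator of `{i ∣ t i ≡ ζ}` lies in `S`;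
* `smul_add_smul_one_sub_mem` — hence `a•e + b•(1 − e) ∈ S` for all scalars `a, b` (informally `ω_K ⊗ 1 = ω·e_K + ω̄·(1 − e_K) ∈ End(T₂B) ⊗ O_L`).

[folklore]
-/

set_option autoImplicit false
-- the Theorems namespace of this sub repeats the summit name by design (D-0017 nested layout)
set_option linter.dupNamespace false

universe u

namespace Summit.BirchSwinnertonDyer.BirchSwinnertonDyer.Theorems.SignedMuAtTwo.CMManinPeriod

open IsLocalRing

/-! ## Cube roots of unity away from `3` -/

section CubeRoot

variable {O : Type*} [CommRing O]

/-- `ζ² + ζ + 1 = 0` ⇒ `(ζ − ζ²)² = −3`. [folklore] -/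
theorem cubeRoot_sub_sq_sq {ζ : O} (hζ : ζ ^ 2 + ζ + 1 = 0) : (ζ - ζ ^ 2) ^ 2 = -3 := by
  linear_combination (ζ ^ 2 - 3 * ζ + 3) * hζ

/-- A primitive cube root of unity has `ζ − ζ²` a unit as soon as `3` is a unit (e.g. over `ℤ₂`). [folklore] -/
theorem isUnit_cubeRoot_sub_sq {ζ : O} (hζ : ζ ^ 2 + ζ + 1 = 0) (h3 : IsUnit (3 : O)) : IsUnit (ζ - ζ ^ 2) := by
  have h : IsUnit ((ζ - ζ ^ 2) ^ 2) := by
    rw [cubeRoot_sub_sq_sq hζ]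
    exact h3.neg
  exact (isUnit_pow_iff two_ne_zero).mp h

variable [IsLocalRing O]

/-- Normalisation, residue `1`: if `t ≡ ζ` then `(t − ζ²)·(ζ − ζ²)⁻¹ ≡ 1 (mod 𝔪)`. [folklore] -/
theorem normalise_residue_one {ζ t : O} (u : Oˣ) (hu : (u : O) = ζ - ζ ^ 2) (ht : t - ζ ∈ maximalIdeal O) :
    (t - ζ ^ 2) * ↑u⁻¹ - 1 ∈ maximalIdeal O := by
  have h : (t - ζ ^ 2) * ↑u⁻¹ - 1 = (t - ζ) * ↑u⁻¹ := by
    have h1 : (u : O) * ↑u⁻¹ = 1 := Units.mul_inv u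
    linear_combination (-(↑u⁻¹ : O)) * hu + h1
  rw [h]
  exact Ideal.mul_mem_right _ _ ht

/-- Normalisation, residue `0`: if `t ≡ ζ²` then `(t − ζ²)·(ζ − ζ²)⁻¹ ∈ 𝔪`. [folklore] -/
theorem normalise_residue_zero {ζ t : O} (u : Oˣ) (ht : t - ζ ^ 2 ∈ maximalIdeal O) :
    (t - ζ ^ 2) * ↑u⁻¹ ∈ maximalIdeal O :=
  Ideal.mul_mem_right _ _ ht

/-- The two residue classes are disjoint: `t ≡ ζ²` and `ζ − ζ²` a unit ⇒ `t ≢ ζ`. [folklore] -/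
theorem not_mem_of_sub_cubeRoot_sq_mem {ζ t : O} (hu : IsUnit (ζ - ζ ^ 2)) (ht : t - ζ ^ 2 ∈ maximalIdeal O) :
    t - ζ ∉ maximalIdeal O := by
  intro h
  have hmem : ζ - ζ ^ 2 ∈ maximalIdeal O := by
    have h2 := (maximalIdeal O).sub_mem ht h
    have h3 : t - ζ ^ 2 - (t - ζ) = ζ - ζ ^ 2 := by ring
    rwa [h3] at h2
  exact (mem_maximalIdeal _).mp hmem hu

omit [IsLocalRing O] in
/-- **CRT for the auxiliary Frobenius** (card: «principal Frobenii `α ≡ 1 (𝔣₀)` hit all of `(𝒪_K/2)ˣ` by CRT»): for coprime ideals `I`, `J`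
(informally `2𝒪_K` and `𝔣₀`, `𝔣₀` odd) and any target residue `r` (informally a lift of `ζ₃ ∈ 𝔽₄`), some `α` has `α ≡ r (mod I)` and
`α ≡ 1 (mod J)`. [folklore] -/
theorem exists_sub_mem_and_sub_one_mem {I J : Ideal O} (hIJ : IsCoprime I J) (r : O) :
    ∃ α : O, α - r ∈ I ∧ α - 1 ∈ J := by
  obtain ⟨i, hi, j, hj, hij⟩ := Ideal.isCoprime_iff_exists.mp hIJ
  refine ⟨r * j + i, ?_, ?_⟩
  · have h : r * j + i - r = (1 - r) * i := by linear_combination r * hij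
    rw [h]
    exact I.mul_mem_left _ hi
  · have h : r * j + i - 1 = (r - 1) * j := by linear_combination hij
    rw [h]
    exact J.mul_mem_left _ hj

end CubeRoot

/-! ## The separating idempotent from cube-root residues -/

section Assembly

variable {O : Type u} [CommRing O] [IsNoetherianRing O] [IsLocalRing O] [IsAdicComplete (maximalIdeal O) O]
  {ι : Type u} [Fintype ι] (S : Subalgebra O (ι → O))

/-- **Step (c) turnkey.**  `O` complete Noetherian local with `3 ∈ Oˣ`, `ζ` a primitive cube root of unity in `O`, `ι` finite, `S ⊆ (ι → O)` any
`O`-subalgebra, `t ∈ S` with `t i ≡ ζ` or `t i ≡ ζ² (mod 𝔪)` for every `i` (informally `t = ρ_B(Frob_(α))`, `α̃ = ζ₃`).  Then the indicator of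
`{i ∣ t i ≡ ζ}` (informally the projector `e_K` onto one `K`-embedding class) lies in `S`. [folklore] -/
theorem indicator_mem_subalgebra_of_cubeRoot_residues {ζ : O} (hζ : ζ ^ 2 + ζ + 1 = 0) (h3 : IsUnit (3 : O)) (t : S)
    (ht : ∀ i, (t : ι → O) i - ζ ∈ maximalIdeal O ∨ (t : ι → O) i - ζ ^ 2 ∈ maximalIdeal O)
    [DecidablePred fun i : ι => (t : ι → O) i - ζ ∈ maximalIdeal O] :
    (fun i => if (t : ι → O) i - ζ ∈ maximalIdeal O then (1 : O) else 0) ∈ S := by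
  classical
  obtain ⟨u, hu⟩ := isUnit_cubeRoot_sub_sq hζ h3
  -- the normalised element t' = (t - ζ²) · u⁻¹ of S
  let t' : S := (t - algebraMap O S (ζ ^ 2)) * algebraMap O S (↑u⁻¹ : O)
  have ht'coe : ∀ i, (t' : ι → O) i = ((t : ι → O) i - ζ ^ 2) * ↑u⁻¹ := by
    intro i
    simp only [t', Subalgebra.coe_mul, Subalgebra.coe_sub, Subalgebra.coe_algebraMap, Pi.mul_apply, Pi.sub_apply,
      Pi.algebraMap_apply, Algebra.algebraMap_self, RingHom.id_apply]
  have ht' : ∀ i, (t' : ι → O) i ∈ maximalIdeal O ∨ (t' : ι → O) i - 1 ∈ maximalIdeal O := by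
    intro i
    rw [ht'coe i]
    rcases ht i with h | h
    · exact Or.inr (normalise_residue_one u hu h)
    · exact Or.inl (normalise_residue_zero u h)
  have hmem := indicator_mem_subalgebra S t' ht'
  -- the two indicator functions coincide
  have hfun : (fun i => if (t : ι → O) i - ζ ∈ maximalIdeal O then (1 : O) else 0)
      = (fun i => if (t' : ι → O) i - 1 ∈ maximalIdeal O then (1 : O) else 0) := by
    funext i
    by_cases h : (t : ι → O) i - ζ ∈ maximalIdeal O
    · rw [if_pos h, if_pos (by rw [ht'coe i]; exact normalise_residue_one u hu h)]
    · rw [if_neg h, if_neg]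
      intro h1
      -- then t i ≡ ζ² (the other class), so t' i ∈ 𝔪, contradicting t' i - 1 ∈ 𝔪
      have h2 : (t : ι → O) i - ζ ^ 2 ∈ maximalIdeal O := (ht i).resolve_left h
      have h0 : (t' : ι → O) i ∈ maximalIdeal O := by rw [ht'coe i]; exact normalise_residue_zero u h2
      have hone : (1 : O) ∈ maximalIdeal O := by simpa using (maximalIdeal O).sub_mem h0 h1
      exact (mem_maximalIdeal 1).mp hone isUnit_one
  rw [hfun]
  exact hmem

omit [IsNoetherianRing O] [IsLocalRing O] [IsAdicComplete (maximalIdeal O) O] [Fintype ι] in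
/-- Once the separating idempotent `e` lies in `S`, so does `a•e + b•(1 − e)` for all scalars (informally `ω_K ⊗ 1 = ω e_K + ω̄ (1 − e_K)`,
whence `𝒪_K ⊗ ℤ₂ ⊆ End(B) ⊗ ℤ₂` after descent). [folklore] -/
theorem smul_add_smul_one_sub_mem {e : ι → O} (he : e ∈ S) (a b : O) : a • e + b • (1 - e) ∈ S :=
  S.add_mem (S.smul_mem he a) (S.smul_mem (S.sub_mem S.one_mem he) b)

end Assembly

end Summit.BirchSwinnertonDyer.BirchSwinnertonDyer.Theorems.SignedMuAtTwo.CMManinPeriod
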